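import Mathlib
import Literature.Probability.Percolation.CardyFormula
import Summits.CriticalPhenomena.CardyFormulaZ2.Theses.CardyBoundaryCoulombGas

/-!
# Sketch — crux-ideate stmt-CriticalPhenomena-5660 (RectilinearCardy), ideator 2, round 1

First lemmas of the crux idea cards, stated over existing declarations only.

* `ExcursionKernelCovariance.ConnectivityCrossRatioLaw` — first lemma of card
  `excursion-kernel-covariance`: for a rectilinear conformal rectangle the four boundary
  arc-to-arc connection probabilities around the marks satisfy
  `P₀₁ P₂₃ / (P₀₂ P₁₃) → η^{-2/3}` (small arcs of radius `r`, `δ → 0⁺` then `r → 0⁺`), `η` the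
  cross-ratio of any uniformizing datum. Map-free on the lattice side; every local factor
  (corner exponents, lattice normalisations `δ^{-2/3}`, arc lengths) cancels in the ratio.
* `ExcursionKernelCovariance.halfPlane_density_eq_excursion_form` — the provable-now identity
  behind the card: on the half-plane, the route's mark density
  `(cardyConst/3) Δ(a,b,c)^{1/3} ((x-a)(x-b)(x-c))^{-2/3}` equals the excursion-kernel expression
  `κ · (H(x,a)H(x,b)H(x,c))^{1/3} (H(a,b)H(b,c)H(a,c))^{-1/6}` with `H(u,v) = 1/(π (u-v)^2)` and
  `κ = cardyConst/3 · π^{1/2}`.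
-/

open scoped Topology
open Filter Set

namespace Summit.CriticalPhenomena.CardyFormulaZ2.Cruxes.RectilinearCardy.ExcursionKernelCovariance

open Literature.Probability.Percolation Literature.Probability.RandomPlanarGeometry

/-- The rectilinearity hypothesis of the crux, verbatim. -/
def IsRectilinear (R : ConformalRectangle) : Prop :=
  ∃ S : Finset (ℂ × ℂ), (∀ p ∈ S, p.1.re = p.2.re ∨ p.1.im = p.2.im) ∧
    frontier R.carrier ⊆ ⋃ p ∈ S, segment ℝ p.1 p.2

/-- `P_{1/2}`-probability that the boundary arcs of radius `r` around the marks `i` and `j` of `R`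
are joined by an open path of `Ω_δ` (G02 discretisation, same conventions as
`bondDomainCrossingProb`). -/
noncomputable def arcConn (R : ConformalRectangle) (r δ : ℝ) (i j : Fin 4) : ℝ :=
  discreteCrossingProb half R.carrier δ (frontier R.carrier ∩ Metric.closedBall (R.pt i) r)
    (frontier R.carrier ∩ Metric.closedBall (R.pt j) r)

/-- FIRST LEMMA (card `excursion-kernel-covariance`): the connectivity cross-ratio law.
For every rectilinear conformal rectangle and every uniformizing datum `(φ, x)`,
`P₀₁·P₂₃/(P₀₂·P₁₃) → (crossRatio x)^{-2/3}` as `δ → 0⁺` and then `r → 0⁺`, where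
`P_ij = arcConn R r δ i j`. It is the `(2;2)` member of the leg family read in a polygon in the
only combination in which all lattice normalisations, corner factors and arc lengths cancel:
`(H₀₁H₂₃/(H₀₂H₁₃))^{1/3}` for the excursion Poisson kernel `H` of ANY simply connected domain
equals `η^{-2/3}`. Necessary for `RectilinearCardy` (small-`η` asymptotics of `cardyFunction`). -/
def ConnectivityCrossRatioLaw : Prop :=
  ∀ R : ConformalRectangle, IsRectilinear R →
    ∀ (φ : ConformalEquiv UpperHalfPlane.upperHalfPlaneSet R.carrier) (x : Fin 4 → ℝ),
      R.IsUniformizing φ x →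
      ∀ ε > 0, ∃ r₀ > 0, ∀ r ∈ Set.Ioo (0 : ℝ) r₀, ∀ᶠ δ in 𝓝[>] (0 : ℝ),
        |arcConn R r δ 0 1 * arcConn R r δ 2 3 / (arcConn R r δ 0 2 * arcConn R r δ 1 3)
          - (crossRatio x) ^ (-(2 / 3 : ℝ))| < ε

/-- The continuum excursion Poisson kernel of the upper half-plane between two boundary points,
`H_ℍ(u, v) = 1 / (π (u - v)^2)` (the boundary limit `∂_{n_u} ∂_{n_v} G_ℍ`). -/
noncomputable def halfPlaneExcursionKernel (u v : ℝ) : ℝ := 1 / (Real.pi * (u - v) ^ 2)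

/-- The excursion-kernel form of a `(1,1,1;3)` boundary density in the half-plane:
`κ (H(x,a)H(x,b)H(x,c))^{1/3} (H(a,b)H(b,c)H(a,c))^{-1/6}`. -/
noncomputable def excursionDensity (κ a b c x : ℝ) : ℝ :=
  κ * (halfPlaneExcursionKernel x a * halfPlaneExcursionKernel x b *
        halfPlaneExcursionKernel x c) ^ (1 / 3 : ℝ) *
      (halfPlaneExcursionKernel a b * halfPlaneExcursionKernel b c *
        halfPlaneExcursionKernel a c) ^ (-(1 / 6 : ℝ))

/-- PROVABLE NOW (support of the card): the route's half-plane mark density (crux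
`HalfPlaneMarkDensityLaw`, stmt-5661) IS an excursion-kernel expression, with
`κ = cardyConst/3 · π^{1/2}`; so the `(1,1,1;3)` law has a map-free, corner-free restatement in
any domain: replace `H_ℍ` by the domain's own excursion kernel. -/
def halfPlane_density_eq_excursion_form : Prop :=
  ∀ a b c x : ℝ, a < b → b < c → c < x →
    cardyConst / 3 * ((b - a) * (c - b) * (c - a)) ^ (1 / 3 : ℝ) *
        ((x - a) * (x - b) * (x - c)) ^ (-(2 / 3) : ℝ)
      = excursionDensity (cardyConst / 3 * Real.pi ^ (1 / 2 : ℝ)) a b c x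

/-- Sanity: the crux this card serves, by name. -/
example : Prop := Summit.CriticalPhenomena.CardyFormulaZ2.Theses.CardyBoundaryCoulombGas.RectilinearCardy

end Summit.CriticalPhenomena.CardyFormulaZ2.Cruxes.RectilinearCardy.ExcursionKernelCovariance
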